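/- Width seat 2/3 `ym-line-cbag-p1-w2` (prover-ym-line-cbag-p1-w2-g20-0) of the cell of ideator ym-idea-2, LINE 8
(route `EguchiKawaiDirectionLadder`), post-closure glue for the barrier entry `EguchiKawaiBreakdown`: CLOSED Wilson words
(zero winding in every direction) are invariant under the centre `U(1)^d` — Makeenko (14.48) «only closed Wilson loops are
invariant» — so their large-`N` factorisation transfers from the `SU(N)` to the `U(N)` single-site model.  Route-independent; YM
mass gap NOT touched (barrier-ledger line). -/
import Summits.QuantumFields.YangMills.Theorems.EguchiKawaiDirectionLadderWilsonWordFactorisation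
import HarnessLib

/-!
# Closed Wilson words of the Eguchi–Kawai model: centre invariance and factorisation in the `U(N)` model

A word `W_l = (1/N) tr U_{μ₁}^{ε₁} ⋯ U_{μ_k}^{ε_k}` picks up `∏_μ c_μ^{q_μ(l)}` under `U_μ ↦ c_μ U_μ` (`|c_μ| = 1`), where
`q_μ(l) = wordCharge l μ` is its winding (`phaseProd_eq_prod_zpow`, Makeenko (14.48)); hence a CLOSED word (`q_μ(l) = 0` for all `μ`)
is phase invariant (`isPhaseInvariant_ekWord_of_closed`), its `U(N)` and `SU(N)` expectations agree (w4's transfer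
`ekExpectation_eq_ekExpectationSU`), and the strong-coupling factorisation of `…WilsonWordFactorisation.lean` holds verbatim in the
`U(N)` model of the barrier file:

* `ekExpectation_var_closedWordRe_le` : `⟨(Re W_l − ⟨Re W_l⟩_EK)²⟩_EK ≤ (M(l)/N)/(N/2 − 8(d−1)N|b|)` for closed `l`;
* `ek_factorisation_closedWordRe` : `|⟨Re W_l Re W_{l'}⟩_EK − ⟨Re W_l⟩_EK ⟨Re W_{l'}⟩_EK| ≤ √(M(l)M(l'))/(N(N/2 − 8(d−1)N|b|))` for
  closed `l`, `l'`, and the limit `tendsto_ek_factorisation_closedWordRe` (`→ 0` as `N → ∞`), `16(d−1)|b| < 1`.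

HONEST FRAMING.  Large-`N` factorisation of closed reduced Wilson loops in the single-site model at STRONG coupling; nothing about
the reduction `W_lattice = W_EK`, the loop equations, or the Yang–Mills mass gap / the summit `YangMills` is proved or advanced.

References: Y. Makeenko, *Methods of Contemporary Gauge Theory* (2023) §14.3 (14.41), (14.47)–(14.48) (PDF pp. 245–246).
-/

set_option autoImplicit false

noncomputable section

open scoped Matrix ComplexConjugate BigOperators
open Matrix Complex Finset MeasureTheory Filter Topology
open Literature.Barriers.QuantumFields (UN EKConfig EKConfigSU ekHaarSU inclSU ekWeight ekExpectation ekExpectationSU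
  IsPhaseInvariant ekExpectation_eq_ekExpectationSU)

namespace Summit.QuantumFields.YangMills.Theorems.EguchiKawaiDirectionLadder

variable {d N : ℕ}

/-! ## The phase of a word is `∏_μ c_μ^{q_μ}` -/

/-- The winding of `a :: l`: one letter adds `±1` in its own direction. -/
theorem wordCharge_cons (a : Fin d × Bool) (l : List (Fin d × Bool)) (μ : Fin d) :
    wordCharge (a :: l) μ = wordCharge l μ + (if a.1 = μ then (if a.2 then 1 else -1) else 0) := by
  obtain ⟨ν, ε⟩ := a
  simp only [wordCharge, wordPlus, wordMinus, List.countP_cons]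
  by_cases h : ν = μ
  · subst h
    cases ε <;> simp <;> ring
  · have h1 : ¬ ((ν, ε) = (μ, true)) := fun e => h (Prod.mk.inj e).1
    have h2 : ¬ ((ν, ε) = (μ, false)) := fun e => h (Prod.mk.inj e).1
    simp [h, h1, h2]

/-- **Makeenko (14.48)**: under `U_ν ↦ c_ν U_ν` with unit phases, the phase picked up by the word `l` is `∏_μ c_μ^{q_μ(l)}`,
`q_μ(l)` its winding in direction `μ`. -/
theorem phaseProd_eq_prod_zpow {c : Fin d → ℂ} (hc : ∀ ν, ‖c ν‖ = 1) (l : List (Fin d × Bool)) :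
    (l.map fun a : Fin d × Bool => if a.2 then c a.1 else conj (c a.1)).prod = ∏ μ : Fin d, c μ ^ wordCharge l μ := by
  have hne : ∀ ν, c ν ≠ 0 := fun ν h => by simpa [h] using hc ν
  induction l with
  | nil => simp [wordCharge, wordPlus, wordMinus]
  | cons a l ih =>
      rw [List.map_cons, List.prod_cons, ih]
      simp only [wordCharge_cons]
      have hsplit : ∏ μ : Fin d, c μ ^ (wordCharge l μ + (if a.1 = μ then (if a.2 then (1 : ℤ) else -1) else 0)) =
          (∏ μ : Fin d, c μ ^ wordCharge l μ) *
            ∏ μ : Fin d, c μ ^ (if a.1 = μ then (if a.2 then (1 : ℤ) else -1) else 0) := by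
        rw [← Finset.prod_mul_distrib]
        exact Finset.prod_congr rfl fun μ _ => zpow_add₀ (hne μ) _ _
      have hone : ∏ μ : Fin d, c μ ^ (if a.1 = μ then (if a.2 then (1 : ℤ) else -1) else 0) =
          c a.1 ^ (if a.2 then (1 : ℤ) else -1) := by
        have : ∀ μ : Fin d, c μ ^ (if a.1 = μ then (if a.2 then (1 : ℤ) else -1) else 0) =
            if a.1 = μ then c a.1 ^ (if a.2 then (1 : ℤ) else -1) else 1 := by
          intro μ
          split_ifs with h <;> simp [h]
        rw [Finset.prod_congr rfl fun μ _ => this μ, Finset.prod_ite_eq]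
        simp
      rw [hsplit, hone, mul_comm]
      congr 1
      obtain ⟨ν, ε⟩ := a
      cases ε
      · simp only [Bool.false_eq_true, if_false]
        rw [_root_.zpow_neg_one]
        exact (Complex.inv_eq_conj (hc ν)).symm
      · simp

/-- **Closed words are centre invariant**: if every winding vanishes, the phase product is `1` for all unit phases. -/
theorem phaseProd_eq_one_of_closed {c : Fin d → ℂ} (hc : ∀ ν, ‖c ν‖ = 1) {l : List (Fin d × Bool)}
    (hl : ∀ μ, wordCharge l μ = 0) :
    (l.map fun a : Fin d × Bool => if a.2 then c a.1 else conj (c a.1)).prod = 1 := by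
  rw [phaseProd_eq_prod_zpow hc l]
  simp [hl]

/-- **A closed word is a phase-invariant observable** («only closed Wilson loops are invariant», Makeenko p. 246). -/
theorem isPhaseInvariant_ekWord_of_closed {l : List (Fin d × Bool)} (hl : ∀ μ, wordCharge l μ = 0) :
    IsPhaseInvariant fun U : EKConfig d N => ekWord l U := by
  intro U U' h
  choose c hc hU using h
  simp only [ekWord, ekWordMatrix_phase hU l, phaseProd_eq_one_of_closed hc hl, one_smul]

/-- The real part of a closed word is phase invariant. -/
theorem isPhaseInvariant_closedWordRe {l : List (Fin d × Bool)} (hl : ∀ μ, wordCharge l μ = 0) :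
    IsPhaseInvariant fun U : EKConfig d N => (ekWord l U).re :=
  (isPhaseInvariant_ekWord_of_closed hl).comp Complex.re

/-- The imaginary part of a closed word is phase invariant. -/
theorem isPhaseInvariant_closedWordIm {l : List (Fin d × Bool)} (hl : ∀ μ, wordCharge l μ = 0) :
    IsPhaseInvariant fun U : EKConfig d N => (ekWord l U).im :=
  (isPhaseInvariant_ekWord_of_closed hl).comp Complex.im

/-- Measurability of the real part of a word. -/
theorem measurable_wordRe (l : List (Fin d × Bool)) : Measurable fun U : EKConfig d N => (ekWord l U).re :=
  (Complex.continuous_re.comp (continuous_ekWord l)).measurable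

/-! ## `U(N)` = `SU(N)` for closed words -/

/-- **`⟨Re W_l⟩_{U(N)} = ⟨Re W_l⟩_{SU(N)}`** for a closed word. -/
theorem ekExpectation_closedWordRe_eq (b : ℝ) {l : List (Fin d × Bool)} (hl : ∀ μ, wordCharge l μ = 0) :
    ekExpectation N b (fun U : EKConfig d N => (ekWord l U).re) =
      ekExpectationSU N b (fun V : EKConfigSU d N => (ekWord l (inclSU V)).re) :=
  ekExpectation_eq_ekExpectationSU b _ (measurable_wordRe l) (isPhaseInvariant_closedWordRe hl)

/-- `U(N)` = `SU(N)` for the centred square of the real part of a closed word. -/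
theorem ekExpectation_var_closedWordRe_eq (b : ℝ) {l : List (Fin d × Bool)} (hl : ∀ μ, wordCharge l μ = 0) (m : ℝ) :
    ekExpectation N b (fun U : EKConfig d N => ((ekWord l U).re - m) ^ 2) =
      ekExpectationSU N b (fun V : EKConfigSU d N => ((ekWord l (inclSU V)).re - m) ^ 2) :=
  ekExpectation_eq_ekExpectationSU b _ (((measurable_wordRe l).sub measurable_const).pow_const 2)
    (((isPhaseInvariant_closedWordRe hl).comp fun x : ℝ => (x - m) ^ 2))

/-- `U(N)` = `SU(N)` for the product of the real parts of two closed words. -/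
theorem ekExpectation_mul_closedWordRe_eq (b : ℝ) {l l' : List (Fin d × Bool)} (hl : ∀ μ, wordCharge l μ = 0)
    (hl' : ∀ μ, wordCharge l' μ = 0) :
    ekExpectation N b (fun U : EKConfig d N => (ekWord l U).re * (ekWord l' U).re) =
      ekExpectationSU N b (fun V : EKConfigSU d N => (ekWord l (inclSU V)).re * (ekWord l' (inclSU V)).re) :=
  ekExpectation_eq_ekExpectationSU b _ ((measurable_wordRe l).mul (measurable_wordRe l'))
    ((isPhaseInvariant_closedWordRe hl).mul (isPhaseInvariant_closedWordRe hl'))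

/-! ## Factorisation of closed words in the `U(N)` Eguchi–Kawai model at strong coupling -/

/-- **Variance of a closed word in the `U(N)` model**: `⟨(Re W_l − ⟨Re W_l⟩_EK)²⟩_EK ≤ (M(l)/N)/(N/2 − 8(d−1)N|b|)` for
`16(d−1)|b| < 1`, `N ≥ 1`. -/
theorem ekExpectation_var_closedWordRe_le (hN : N ≠ 0) {b : ℝ} (hb : 16 * ((d : ℝ) - 1) * |b| < 1)
    {l : List (Fin d × Bool)} (hl : ∀ μ, wordCharge l μ = 0) :
    ekExpectation N b (fun U : EKConfig d N => ((ekWord l U).re -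
        ekExpectation N b (fun U => (ekWord l U).re)) ^ 2) ≤
      ((∑ μ : Fin d, (wordMult l μ : ℝ) ^ 2) / N) / ((N : ℝ) / 2 - 8 * ((d : ℝ) - 1) * N * |b|) := by
  rw [ekExpectation_closedWordRe_eq b hl, ekExpectation_var_closedWordRe_eq b hl]
  exact ekExpectationSU_var_wordRe_le hN hb l

/-- **Large-`N` factorisation of closed Wilson words in the `U(N)` Eguchi–Kawai model at strong coupling**:
`|⟨Re W_l · Re W_{l'}⟩_EK − ⟨Re W_l⟩_EK ⟨Re W_{l'}⟩_EK| ≤ √(M(l) M(l')) / (N (N/2 − 8(d−1)N|b|))` for closed words `l`, `l'`,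
`16(d−1)|b| < 1`, `N ≥ 1`. -/
theorem ek_factorisation_closedWordRe (hN : N ≠ 0) {b : ℝ} (hb : 16 * ((d : ℝ) - 1) * |b| < 1)
    {l l' : List (Fin d × Bool)} (hl : ∀ μ, wordCharge l μ = 0) (hl' : ∀ μ, wordCharge l' μ = 0) :
    |ekExpectation N b (fun U : EKConfig d N => (ekWord l U).re * (ekWord l' U).re) -
        ekExpectation N b (fun U => (ekWord l U).re) * ekExpectation N b (fun U => (ekWord l' U).re)| ≤
      Real.sqrt ((∑ μ : Fin d, (wordMult l μ : ℝ) ^ 2) * (∑ μ : Fin d, (wordMult l' μ : ℝ) ^ 2)) /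
        (N * ((N : ℝ) / 2 - 8 * ((d : ℝ) - 1) * N * |b|)) := by
  rw [ekExpectation_mul_closedWordRe_eq b hl hl', ekExpectation_closedWordRe_eq b hl, ekExpectation_closedWordRe_eq b hl']
  exact ek_factorisation_wordRe hN hb l l'

/-- **Factorisation in the large-`N` limit, `U(N)` model**: for closed words `l`, `l'` and `16(d−1)|b| < 1`,
`⟨Re W_l Re W_{l'}⟩_EK − ⟨Re W_l⟩_EK ⟨Re W_{l'}⟩_EK → 0` as `N → ∞`. -/
theorem tendsto_ek_factorisation_closedWordRe {b : ℝ} (hb : 16 * ((d : ℝ) - 1) * |b| < 1)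
    {l l' : List (Fin d × Bool)} (hl : ∀ μ, wordCharge l μ = 0) (hl' : ∀ μ, wordCharge l' μ = 0) :
    Tendsto (fun N : ℕ => ekExpectation N b (fun U : EKConfig d N => (ekWord l U).re * (ekWord l' U).re) -
        ekExpectation N b (fun U => (ekWord l U).re) * ekExpectation N b (fun U => (ekWord l' U).re)) atTop (𝓝 0) := by
  refine (tendsto_ek_factorisation_wordRe hb l l').congr fun N => ?_
  rw [ekExpectation_mul_closedWordRe_eq b hl hl', ekExpectation_closedWordRe_eq b hl, ekExpectation_closedWordRe_eq b hl']

end Summit.QuantumFields.YangMills.Theorems.EguchiKawaiDirectionLadder
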